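import Summits.QuantumAdvantage.QuantumAdvantage.Theorems.PairFreezingA

/-! # PairFreezingB — part 2/8 (mechanical split for landing of `PairFreezing`; content verbatim; scopes re-opened with their variables) -/

set_option linter.dupNamespace false -- D-0017: single-problem summit ⇒ `QuantumAdvantage.QuantumAdvantage` by design
noncomputable section

namespace Summit.QuantumAdvantage.QuantumAdvantage.Theorems.PairFreezing
open Classical Finset Summit.QuantumAdvantage.AdviceFreeQNC0
open Literature.Computability.MetaComplexity Literature.Computability.MetaComplexity.Smolensky
open Literature.Computability.Complexity (parityFn)
open Summit.QuantumAdvantage.QuantumAdvantage.Theses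
open Summit.QuantumAdvantage.AdviceFreeQNC0.TransferWalk (wtPrefix_zero)
variable {n : ℕ}

namespace Pairing
variable (π : Pairing n)


/-- **PAIR FREEZING — the win bit.**  Flipping a set `J` of RELEVANT free pairs toggles the fixed table's win bit
`|J|` times: every cut other than the middle cuts of `J` sees the same walk exponent, and at the middle cut of a
relevant pair the two orientations give complementary charged-bits (`κ_i ≢ 1`). -/
theorem ringWinU_flip (c : ℕ) (tab : Fin (n + 1) → Bool) (u : Fin n → Bool) {J : Finset (Fin π.P)}
    (hJ : J ⊆ π.rel c tab u) :
    ringWinU c (fun h _ => tab h) (π.flip u J) =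
      xor (ringWinU c (fun h _ => tab h) u) (decide (J.card % 2 = 1)) := by
  have hP := π.le
  have hJa : ∀ i ∈ J, u (π.fst i) ≠ u (π.snd i) := fun i hi => π.rel_subset_anti c tab u i (hJ hi)
  set u' := π.flip u J with hu'
  set H : Finset (Fin (n + 1)) := J.map ⟨π.mid, π.mid_injective⟩ with hH
  have hHcard : H.card = J.card := by rw [hH, card_map]
  have hmemH : ∀ h : Fin (n + 1), h ∉ H → ∀ i ∈ J, h ≠ π.mid i := by
    intro h hn i hi heq
    rw [hH, mem_map] at hn
    exact hn ⟨i, hi, heq.symm⟩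
  -- split the charged-cut count along `H`
  have hsplit : ∀ v : Fin n → Bool, (chg c tab v).card =
      ((chg c tab v).filter fun h => h ∈ H).card + ((chg c tab v).filter fun h => h ∉ H).card :=
    fun v => (Finset.card_filter_add_card_filter_not _).symm
  -- off `H`: identical
  have hoff : ((chg c tab u').filter fun h => h ∉ H) = ((chg c tab u).filter fun h => h ∉ H) := by
    ext h
    simp only [chg, mem_filter, mem_univ, true_and]
    constructor
    · rintro ⟨hc, hn⟩
      refine ⟨?_, hn⟩
      rwa [hu', π.walkExp_flip_of_not_mid u hJa h (hmemH h hn)] at hc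
    · rintro ⟨hc, hn⟩
      refine ⟨?_, hn⟩
      rwa [hu', π.walkExp_flip_of_not_mid u hJa h (hmemH h hn)]
  -- on `H`: the filters are filters of `H`
  have honH : ∀ v : Fin n → Bool, ((chg c tab v).filter fun h => h ∈ H) =
      H.filter fun h => tab h = true ∧ (c + h.val + walkExp v h.val) % 3 ≠ 0 := by
    intro v
    ext h
    simp only [chg, mem_filter, mem_univ, true_and]
    tauto
  -- on `H`: complementary
  have hon : (H.filter fun h => tab h = true ∧ (c + h.val + walkExp u' h.val) % 3 ≠ 0) =
      H.filter fun h => ¬ (tab h = true ∧ (c + h.val + walkExp u h.val) % 3 ≠ 0) := by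
    refine Finset.filter_congr fun h hh => ?_
    rw [hH, mem_map] at hh
    obtain ⟨i, hi, rfl⟩ := hh
    have hrel := hJ hi
    unfold rel at hrel
    rw [mem_filter] at hrel
    obtain ⟨_, htab, hanti, hk⟩ := hrel
    change (tab (π.mid i) = true ∧ (c + (π.mid i).val + walkExp u' (π.mid i).val) % 3 ≠ 0) ↔
      ¬ (tab (π.mid i) = true ∧ (c + (π.mid i).val + walkExp u (π.mid i).val) % 3 ≠ 0)
    rw [π.walkExp_mid c u' i, π.walkExp_mid c u i, hu', π.kappa_flip c u hJa i, flip_fst,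
      decide_eq_true hi]
    simp only [htab, true_and, Bool.xor_true]
    cases hb : u (π.fst i)
    · simp only [Bool.not_false, ↓reduceIte, Bool.false_eq_true]
      omega
    · simp only [Bool.not_true, Bool.false_eq_true, ↓reduceIte]
      omega
  have hHsum := Finset.card_filter_add_card_filter_not (s := H)
    (p := fun h => tab h = true ∧ (c + h.val + walkExp u h.val) % 3 ≠ 0)
  have hcnt : (chg c tab u').card % 2 = ((chg c tab u).card + J.card) % 2 := by
    have e1 := hsplit u'
    have e2 := hsplit u
    rw [honH u', hon, hoff] at e1
    rw [honH u] at e2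
    rw [← hHcard]
    omega
  rw [ringWinU_tab_eq c tab u', ringWinU_tab_eq c tab u, hcnt]
  rcases Nat.mod_two_eq_zero_or_one (chg c tab u).card with h0 | h0 <;>
    rcases Nat.mod_two_eq_zero_or_one J.card with h1 | h1 <;>
    simp [Nat.add_mod, h0, h1]


/-! #### classes of the pair-freezing partition: representatives and free orientation bits -/

section Classes

variable (c : ℕ) (tab : Fin (n + 1) → Bool)

/-- the relevant free pairs of `u` whose first bit is `true` (flipping them normalises `u`). -/
def J0 (u : Fin n → Bool) : Finset (Fin π.P) := (π.rel c tab u).filter fun i => u (π.fst i) = true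

/-- the representative of the class of `u`: all relevant free pairs oriented `(false, true)`. -/
def rep (u : Fin n → Bool) : Fin n → Bool := π.flip u (π.J0 c tab u)

/-- Pair-freezing helper `J0_subset` (lens-4 g4 machinery; see the enclosing section docstring). -/
theorem J0_subset (u : Fin n → Bool) : π.J0 c tab u ⊆ π.rel c tab u := filter_subset _ _

/-- Pair-freezing helper `J0_anti` (lens-4 g4 machinery; see the enclosing section docstring). -/
theorem J0_anti (u : Fin n → Bool) : ∀ i ∈ π.J0 c tab u, u (π.fst i) ≠ u (π.snd i) :=
  fun i hi => π.rel_subset_anti c tab u i (π.J0_subset c tab u hi)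

/-- Pair-freezing helper `rel_rep` (lens-4 g4 machinery; see the enclosing section docstring). -/
theorem rel_rep (u : Fin n → Bool) : π.rel c tab (π.rep c tab u) = π.rel c tab u :=
  π.rel_flip c tab u (π.J0_anti c tab u)

/-- Pair-freezing helper `rep_fst` (lens-4 g4 machinery; see the enclosing section docstring). -/
theorem rep_fst (u : Fin n → Bool) (i : Fin π.P) (hi : i ∈ π.rel c tab u) : π.rep c tab u (π.fst i) = false := by
  unfold rep
  rw [flip_fst]
  have h : i ∈ π.J0 c tab u ↔ u (π.fst i) = true := by
    unfold J0; rw [mem_filter]; simp [hi]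
  rw [Bool.decide_congr h]
  cases u (π.fst i) <;> simp

/-- Pair-freezing helper `rep_rep` (lens-4 g4 machinery; see the enclosing section docstring). -/
theorem rep_rep (u : Fin n → Bool) : π.rep c tab (π.rep c tab u) = π.rep c tab u := by
  have hJ : π.J0 c tab (π.rep c tab u) = ∅ := by
    unfold J0
    refine filter_eq_empty_iff.mpr fun i hi => ?_
    rw [rel_rep] at hi
    rw [π.rep_fst c tab u i hi]
    exact Bool.false_ne_true
  show π.flip (π.rep c tab u) (π.J0 c tab (π.rep c tab u)) = π.rep c tab u
  rw [hJ, flip_empty]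

/-- a representative has all its relevant free pairs oriented `(false, true)`. -/
theorem fst_of_isRep {r : Fin n → Bool} (hr : π.rep c tab r = r) (i : Fin π.P) (hi : i ∈ π.rel c tab r) :
    r (π.fst i) = false := by
  have h := π.rep_fst c tab r i hi
  rwa [hr] at h

/-- number of free bits of the class of `r`. -/
def m (r : Fin n → Bool) : ℕ := (π.rel c tab r).card

/-- the increasing enumeration of the relevant free pairs of `r`. -/
def emb (r : Fin n → Bool) : Fin (π.m c tab r) ↪o Fin π.P := (π.rel c tab r).orderEmbOfFin rfl

/-- Pair-freezing helper `emb_mem` (lens-4 g4 machinery; see the enclosing section docstring). -/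
theorem emb_mem (r : Fin n → Bool) (k : Fin (π.m c tab r)) : π.emb c tab r k ∈ π.rel c tab r :=
  Finset.orderEmbOfFin_mem _ _ k

/-- Pair-freezing helper `emb_surj` (lens-4 g4 machinery; see the enclosing section docstring). -/
theorem emb_surj (r : Fin n → Bool) {i : Fin π.P} (hi : i ∈ π.rel c tab r) : ∃ k, π.emb c tab r k = i := by
  have h : Set.range (π.emb c tab r) = ↑(π.rel c tab r) := Finset.range_orderEmbOfFin _ _
  have : i ∈ Set.range (π.emb c tab r) := by
    rw [h]; exact hi
  exact this

/-- the set of pairs flipped by the free bits `z`. -/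
def Jz (r : Fin n → Bool) (z : Fin (π.m c tab r) → Bool) : Finset (Fin π.P) :=
  (univ.filter fun k => z k = true).map (π.emb c tab r).toEmbedding

/-- Pair-freezing helper `Jz_subset` (lens-4 g4 machinery; see the enclosing section docstring). -/
theorem Jz_subset (r : Fin n → Bool) (z : Fin (π.m c tab r) → Bool) : π.Jz c tab r z ⊆ π.rel c tab r := by
  intro i hi
  unfold Jz at hi
  rw [mem_map] at hi
  obtain ⟨k, _, rfl⟩ := hi
  exact π.emb_mem c tab r k

/-- Pair-freezing helper `mem_Jz` (lens-4 g4 machinery; see the enclosing section docstring). -/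
theorem mem_Jz (r : Fin n → Bool) (z : Fin (π.m c tab r) → Bool) (k : Fin (π.m c tab r)) :
    π.emb c tab r k ∈ π.Jz c tab r z ↔ z k = true := by
  unfold Jz
  rw [mem_map]
  constructor
  · rintro ⟨k', hk', heq⟩
    have hkk : k' = k := (π.emb c tab r).injective heq
    rw [mem_filter] at hk'
    rw [← hkk]
    exact hk'.2
  · intro hz
    exact ⟨k, by rw [mem_filter]; exact ⟨mem_univ _, hz⟩, rfl⟩

/-- Pair-freezing helper `card_Jz` (lens-4 g4 machinery; see the enclosing section docstring). -/
theorem card_Jz (r : Fin n → Bool) (z : Fin (π.m c tab r) → Bool) :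
    (π.Jz c tab r z).card = (univ.filter fun k => z k = true).card := by
  unfold Jz
  rw [card_map]

/-- **the parametrisation of the class of `r` by its free orientation bits.** -/
def e (r : Fin n → Bool) (z : Fin (π.m c tab r) → Bool) : Fin n → Bool := π.flip r (π.Jz c tab r z)

/-- Pair-freezing helper `e_fst` (lens-4 g4 machinery; see the enclosing section docstring). -/
theorem e_fst (r : Fin n → Bool) (z : Fin (π.m c tab r) → Bool) (k : Fin (π.m c tab r)) :
    π.e c tab r z (π.fst (π.emb c tab r k)) = xor (r (π.fst (π.emb c tab r k))) (z k) := by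
  unfold e
  rw [flip_fst]
  congr 1
  rw [Bool.decide_congr (π.mem_Jz c tab r z k)]
  cases z k <;> simp

/-- Pair-freezing helper `e_snd` (lens-4 g4 machinery; see the enclosing section docstring). -/
theorem e_snd (r : Fin n → Bool) (z : Fin (π.m c tab r) → Bool) (k : Fin (π.m c tab r)) :
    π.e c tab r z (π.snd (π.emb c tab r k)) = xor (r (π.snd (π.emb c tab r k))) (z k) := by
  unfold e
  rw [flip_snd]
  congr 1
  rw [Bool.decide_congr (π.mem_Jz c tab r z k)]
  cases z k <;> simp

/-- off the coordinates of the relevant free pairs the class is constant. -/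
theorem e_of_not_free (r : Fin n → Bool) (z : Fin (π.m c tab r) → Bool) (j : Fin n)
    (hj : ∀ k, j ≠ π.fst (π.emb c tab r k) ∧ j ≠ π.snd (π.emb c tab r k)) : π.e c tab r z j = r j := by
  unfold e
  refine π.flip_of_mask_false r (π.mask_eq_false fun i hi => ?_)
  unfold Jz at hi
  rw [mem_map] at hi
  obtain ⟨k, _, rfl⟩ := hi
  exact hj k

/-- Pair-freezing helper `e_injective` (lens-4 g4 machinery; see the enclosing section docstring). -/
theorem e_injective (r : Fin n → Bool) : Function.Injective (π.e c tab r) := by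
  intro z z' h
  funext k
  have h1 := congrFun h (π.fst (π.emb c tab r k))
  rw [e_fst, e_fst] at h1
  revert h1
  cases r (π.fst (π.emb c tab r k)) <;> cases z k <;> cases z' k <;> simp

/-- Pair-freezing helper `rel_e` (lens-4 g4 machinery; see the enclosing section docstring). -/
theorem rel_e (r : Fin n → Bool) (z : Fin (π.m c tab r) → Bool) : π.rel c tab (π.e c tab r z) = π.rel c tab r :=
  π.rel_flip c tab r fun i hi => π.rel_subset_anti c tab r i (π.Jz_subset c tab r z hi)

/-- **the free bits drive the win bit as a PARITY**: `W(e_r z) = W(r) ⊕ PARITY(z)`. -/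
theorem ringWinU_e (r : Fin n → Bool) (z : Fin (π.m c tab r) → Bool) :
    ringWinU c (fun h _ => tab h) (π.e c tab r z) = xor (ringWinU c (fun h _ => tab h) r) (parityFn _ z) := by
  unfold e
  rw [π.ringWinU_flip c tab r (π.Jz_subset c tab r z), card_Jz]
  rfl

/-- Pair-freezing helper `rep_e` (lens-4 g4 machinery; see the enclosing section docstring). -/
theorem rep_e {r : Fin n → Bool} (hr : π.rep c tab r = r) (z : Fin (π.m c tab r) → Bool) :
    π.rep c tab (π.e c tab r z) = r := by
  have hJ0 : π.J0 c tab (π.e c tab r z) = π.Jz c tab r z := by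
    unfold J0
    rw [rel_e]
    ext i
    rw [mem_filter]
    constructor
    · rintro ⟨hi, hbit⟩
      obtain ⟨k, rfl⟩ := π.emb_surj c tab r hi
      rw [e_fst, π.fst_of_isRep c tab hr _ hi, Bool.false_xor] at hbit
      exact (π.mem_Jz c tab r z k).2 hbit
    · intro hi
      have hi' := π.Jz_subset c tab r z hi
      refine ⟨hi', ?_⟩
      obtain ⟨k, rfl⟩ := π.emb_surj c tab r hi'
      rw [e_fst, π.fst_of_isRep c tab hr _ hi', Bool.false_xor]
      exact (π.mem_Jz c tab r z k).1 hi
  show π.flip (π.e c tab r z) (π.J0 c tab (π.e c tab r z)) = r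
  rw [hJ0]
  exact π.flip_flip r _

/-- Pair-freezing helper `e_surj` (lens-4 g4 machinery; see the enclosing section docstring). -/
theorem e_surj {r : Fin n → Bool} {u : Fin n → Bool} (hu : π.rep c tab u = r) : ∃ z, π.e c tab r z = u := by
  have hrel : π.rel c tab r = π.rel c tab u := by rw [← hu, rel_rep]
  refine ⟨fun k => decide (π.emb c tab r k ∈ π.J0 c tab u), ?_⟩
  have hJ : π.Jz c tab r (fun k => decide (π.emb c tab r k ∈ π.J0 c tab u)) = π.J0 c tab u := by
    ext i
    constructor
    · intro hi
      unfold Jz at hi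
      rw [mem_map] at hi
      obtain ⟨k, hk, rfl⟩ := hi
      rw [mem_filter, decide_eq_true_eq] at hk
      exact hk.2
    · intro hi
      have hi' : i ∈ π.rel c tab r := by rw [hrel]; exact π.J0_subset c tab u hi
      obtain ⟨k, rfl⟩ := π.emb_surj c tab r hi'
      rw [mem_Jz, decide_eq_true_eq]
      exact hi
  unfold e
  rw [hJ, ← hu]
  exact π.flip_flip u _

/-- **a class is exactly the image of its parametrisation.** -/
theorem filter_rep_eq {r : Fin n → Bool} (hr : π.rep c tab r = r) :
    (univ.filter fun u => π.rep c tab u = r) = univ.map ⟨π.e c tab r, π.e_injective c tab r⟩ := by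
  ext u
  simp only [mem_filter, mem_univ, true_and, mem_map, Function.Embedding.coeFn_mk]
  constructor
  · intro hu
    exact π.e_surj c tab hu
  · rintro ⟨z, rfl⟩
    exact π.rep_e c tab hr z

/-- Pair-freezing helper `card_class` (lens-4 g4 machinery; see the enclosing section docstring). -/
theorem card_class {r : Fin n → Bool} (hr : π.rep c tab r = r) :
    (univ.filter fun u => π.rep c tab u = r).card = 2 ^ (π.m c tab r) := by
  rw [π.filter_rep_eq c tab hr, card_map, card_univ, Fintype.card_fun, Fintype.card_bool, Fintype.card_fin]

/-- counting inside a class through the parametrisation (Boolean predicates keep decidability canonical). -/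
theorem card_filter_class {r : Fin n → Bool} (hr : π.rep c tab r = r) (A : (Fin n → Bool) → Bool) :
    (univ.filter fun u => A u = true ∧ π.rep c tab u = r).card = (univ.filter fun z => A (π.e c tab r z) = true).card := by
  have h1 : (univ.filter fun u => A u = true ∧ π.rep c tab u = r) =
      (univ.filter fun u => π.rep c tab u = r).filter fun u => A u = true := by
    ext u; simp only [mem_filter, mem_univ, true_and]; tauto
  rw [h1, π.filter_rep_eq c tab hr, Finset.filter_map, card_map]
  rfl

end Classes

/-! #### the per-class parity bound and the deterministic core inequality -/

section Core

variable (c : ℕ) (tab : Fin (n + 1) → Bool)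

/-- each parity class is half of the cube `{0,1}^m`, `m ≥ 1`. -/
theorem card_filter_parityFn (m : ℕ) (hm : 1 ≤ m) (b : Bool) :
    (univ.filter fun z : Fin m → Bool => parityFn m z = b).card = 2 ^ (m - 1) := by
  set e0 : Fin m := ⟨0, hm⟩ with he0
  set φ : (Fin m → Bool) → (Fin m → Bool) := fun z => Function.update z e0 (!z e0) with hφ
  have hφφ : ∀ z, φ (φ z) = z := by
    intro z; funext i
    by_cases hi : i = e0
    · subst hi; simp [hφ]
    · simp [hφ, hi]
  have hpar : ∀ z, parityFn m (φ z) = !parityFn m z := by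
    intro z
    have hS : (univ.filter fun i => φ z i = true) =
        if z e0 = true then (univ.filter fun i => z i = true).erase e0
        else insert e0 (univ.filter fun i => z i = true) := by
      split_ifs with h0
      · ext i
        rw [mem_erase, mem_filter, mem_filter]
        by_cases hi : i = e0
        · subst hi; simp [hφ, h0]
        · simp [hφ, hi]
      · ext i
        rw [mem_insert, mem_filter, mem_filter]
        by_cases hi : i = e0
        · subst hi; simp [hφ, h0]
        · simp [hφ, hi]
    unfold parityFn Literature.Computability.Complexity.GateFn.numOnes
    rw [hS]
    split_ifs with h0
    · have hmem : e0 ∈ (univ.filter fun i => z i = true) := by rw [mem_filter]; exact ⟨mem_univ _, h0⟩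
      rw [card_erase_of_mem hmem]
      have hpos := card_pos.2 ⟨e0, hmem⟩
      rcases Nat.mod_two_eq_zero_or_one (univ.filter fun i => z i = true).card with h | h
      · have h' : ((univ.filter fun i => z i = true).card - 1) % 2 = 1 := by omega
        rw [h, h']; decide
      · have h' : ((univ.filter fun i => z i = true).card - 1) % 2 = 0 := by omega
        rw [h, h']; decide
    · have hmem : e0 ∉ (univ.filter fun i => z i = true) := by rw [mem_filter]; simp [h0]
      rw [card_insert_of_notMem hmem]
      rcases Nat.mod_two_eq_zero_or_one (univ.filter fun i => z i = true).card with h | h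
      · have h' : ((univ.filter fun i => z i = true).card + 1) % 2 = 1 := by omega
        rw [h, h']; decide
      · have h' : ((univ.filter fun i => z i = true).card + 1) % 2 = 0 := by omega
        rw [h, h']; decide
  have hle : ∀ b : Bool, (univ.filter fun z : Fin m → Bool => parityFn m z = b).card ≤
      (univ.filter fun z : Fin m → Bool => parityFn m z = !b).card := by
    intro b
    refine Finset.card_le_card_of_injOn φ (fun z hz => ?_) (fun z _ z' _ h => ?_)
    · rw [mem_coe, mem_filter] at hz ⊢
      exact ⟨mem_univ _, by rw [hpar, hz.2]⟩
    · rw [← hφφ z, h, hφφ]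
  have hsum : (univ.filter fun z : Fin m → Bool => parityFn m z = b).card +
      (univ.filter fun z : Fin m → Bool => parityFn m z = !b).card = 2 ^ m := by
    have h := Finset.card_filter_add_card_filter_not (s := (univ : Finset (Fin m → Bool)))
      (p := fun z => parityFn m z = b)
    rw [card_univ, Fintype.card_fun, Fintype.card_bool, Fintype.card_fin] at h
    rw [← h]
    congr 1
    refine congrArg _ (Finset.filter_congr fun z _ => ?_)
    cases parityFn m z <;> cases b <;> simp
  have h1 := hle b
  have h2 := hle (!b)
  rw [Bool.not_not] at h2
  have hpow : 2 ^ m = 2 * 2 ^ (m - 1) := by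
    rw [← pow_succ']; congr 1; omega
  omega

end Core
end Pairing
end Summit.QuantumAdvantage.QuantumAdvantage.Theorems.PairFreezing
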